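import Literature.AlgebraicGeometry.Resolution.CofinalityFromPrincipalization
import Literature.AlgebraicGeometry.Resolution.ModelTransport
import Literature.AlgebraicGeometry.Resolution.LocalModels
import Literature.AlgebraicGeometry.Resolution.DimensionFormula
import HarnessLib

/-!
# Cofinality of local uniformizations from principalization, II: the hypothesis (COF)

Topic: `Literature/AlgebraicGeometry/Resolution`. PROOF side of `CossartPiltant2019ReductionP`
(`ArithmeticalThreefoldsLocal.lean`): the hypothesis (COF) of `cossartPiltant2019ReductionP_of_parts`
(`ArithmeticalThreefoldsLocalSeparableClimb.lean`) — cofinality of local uniformizations, [CoP1]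
Cor. 4.6 ("for any local model `R₀` of `V/k`, there exists a local uniformization `R₁` of `V/k`
such that `R₀ < R₁`"; proof: "Write `xᵢ = fᵢ/gᵢ` … By proposition 4.2, with `X := Spec R` and
`I := (fᵢ, gᵢ)`, there exists an iterated monoidal transform `R′` of `R` along `V` such that
`xᵢ ∈ R′`. By induction on `n` …") — DERIVED from the named fact
`CossartPiltant2019Principalization` (Cossart–Piltant 2019, Prop. 4.4 = [CoP1] Prop. 4.2 made
characteristic free) in the climbing frame of the reduction: for a model `S[t] ⊆ O_E` of a
subfield `M ∋ S` regular at the centre of `v` and finitely many `x ∈ O_E ∩ M`, there is a finer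
model `S[t′]`, `t ⊆ t′ ⊆ M`, regular at the centre, whose local ring contains the `x`.

* `exists_model_mem_localRing_of_principalization` — PROVED: one element `x = a/b`:
  principalize `(a, b)` on `Spec S[t]_P` (a regular local excellent domain of dimension three:
  `spec_satisfies_principalization_hypotheses`), a resolution by `IsRegularCentreBlowupSeq.isResolution`;
  `exists_fg_regular_mem_of_isResolution` gives a finitely generated `S[t]_P[g₁, …, g_m] ⊆ O_v`
  regular at the centre and containing `x`; `S[t, g] ⊆ S[t]_P[g] ⊆ S[t, g]_{centre}` has the same
  local ring (`ModelTransport.lean`).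
* `cofinality_of_principalization` — PROVED: **`CossartPiltant2019Principalization` implies the
  hypothesis (COF) of `cossartPiltant2019ReductionP_of_parts`** (induction on the finite set of
  elements; the statement omits the redundant `[IsDomain S]` binder of (COF), so it is fed to
  `cossartPiltant2019ReductionP_of_parts` as
  `fun p hp S _ _ _ => cofinality_of_principalization h44 p hp S`).

Everything is PROVED; no named facts are introduced (principalization enters as the hypothesis
`h44 : CossartPiltant2019Principalization`).

## Sources

* V. Cossart, O. Piltant, J. Algebra 320 (2008) 1051–1082, Cor. 4.6 and its proof (HAL
  hal-00139124, p. 14). [CossartPiltant2008]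
* V. Cossart, O. Piltant, J. Algebra 529 (2019), Prop. 4.4 and proof of Prop. 4.10 ("By
  proposition 4.4, it can be assumed that `fᵢ ∈ Tʳ`"). [CossartPiltant2019]
-/

noncomputable section

open CategoryTheory AlgebraicGeometry IsLocalRing Polynomial

namespace Literature.AlgebraicGeometry.Resolution

universe u

open Scheme.IdealSheafData

/-! ## Bookkeeping -/

/-- Two descriptions `R₁ = R₂` of the same subalgebra, with centres both cut out by `v < 1`, have
isomorphic local rings at the centre. [folklore] -/
private theorem isRegularLocalRing_localization_iff_of_subalgebra_eq₃ {S L : Type u} [CommRing S]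
    [Field L] [Algebra S L] (O : ValuationSubring L) {R₁ R₂ : Subalgebra S L} (h : R₁ = R₂)
    (P₁ : Ideal R₁) [P₁.IsPrime] (hP₁ : ∀ x : R₁, x ∈ P₁ ↔ O.valuation (x : L) < 1)
    (P₂ : Ideal R₂) [P₂.IsPrime] (hP₂ : ∀ x : R₂, x ∈ P₂ ↔ O.valuation (x : L) < 1) :
    IsRegularLocalRing (Localization.AtPrime P₁) ↔ IsRegularLocalRing (Localization.AtPrime P₂) := by
  subst h
  have hP : P₁ = P₂ := by ext x; rw [hP₁, hP₂]
  subst hP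
  exact Iff.rfl

/-- Elements of the subfield generated by `S` and `t` are fractions of elements of `S[t]`.
[folklore] -/
private theorem exists_div_eq_of_mem_closure' {S Ω : Type u} [CommRing S] [Field Ω] [Algebra S Ω]
    (t : Set Ω) {z : Ω} (hz : z ∈ Subfield.closure (Set.range (algebraMap S Ω) ∪ t)) :
    ∃ a b : Ω, a ∈ Algebra.adjoin S t ∧ b ∈ Algebra.adjoin S t ∧ b ≠ 0 ∧ z = a / b := by
  obtain ⟨y, hy, w, hw, hyw⟩ := Subfield.mem_closure_iff.mp hz
  rw [← Algebra.adjoin_eq_ring_closure] at hy hw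
  by_cases hw0 : w = 0
  · refine ⟨0, 1, zero_mem _, one_mem _, one_ne_zero, ?_⟩
    rw [← hyw, hw0, div_zero, zero_div]
  · exact ⟨y, w, hy, hw, hw0, hyw.symm⟩

/-- **Back to the base `S`** (abstract local base, to keep instance search syntactic): for a
model `T₀ ⊆ E` with centre `P₀`, its localization `Sₚ` realised in `E` and in an intermediate
field `K`, and an `Sₚ`-subalgebra `T₂ ⊆ K` inside the valuation ring, regular at the centre and
generated by `u` (read in `E`), the model `S[T₀ ∪ u]` is regular at the centre
(`isRegularLocalRing_localization_map_iff` + `isRegularLocalRing_localization_adjoin_union_iff`).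
[folklore] -/
private theorem isRegularLocalRing_adjoin_union_of_map_eq {S E : Type u} [CommRing S] [Field E]
    [Algebra S E] (OE : ValuationSubring E) (T₀ : Subalgebra S E) (P₀ : Ideal T₀) [P₀.IsPrime]
    (hP₀ : ∀ z : T₀, z ∈ P₀ ↔ OE.valuation (z : E) < 1)
    (Sₚ : Type u) [CommRing Sₚ] [Algebra T₀ Sₚ] [IsLocalization.AtPrime Sₚ P₀] [Algebra Sₚ E]
    [IsScalarTower T₀ Sₚ E] [Algebra S Sₚ] [IsScalarTower S Sₚ E]
    (K : Type u) [Field K] [Algebra Sₚ K] [Algebra K E] [IsScalarTower Sₚ K E]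
    (T₂ : Subalgebra Sₚ K) (hT₂O : T₂.toSubring ≤ (OE.comap (algebraMap K E)).toSubring)
    (hT₂reg : IsRegularLocalRing (Localization.AtPrime (Ideal.comap (Subring.inclusion hT₂O)
      (maximalIdeal (OE.comap (algebraMap K E))))))
    (u : Set E)
    (hu : (T₂.map (IsScalarTower.toAlgHom Sₚ K E) : Subalgebra Sₚ E) = Algebra.adjoin Sₚ u)
    (hAO : (Algebra.adjoin S ((T₀ : Set E) ∪ u)).toSubring ≤ OE.toSubring) :
    IsRegularLocalRing (Localization.AtPrime
      (Ideal.comap (Subring.inclusion hAO) (maximalIdeal OE))) := by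
  classical
  let valₐ : K →ₐ[Sₚ] E := IsScalarTower.toAlgHom Sₚ K E
  have hRuO : ∀ z : E, z ∈ Algebra.adjoin Sₚ u → z ∈ OE := by
    intro z hz
    rw [← hu] at hz
    obtain ⟨w, hw, rfl⟩ := Subalgebra.mem_map.mp hz
    exact hT₂O hw
  let P₂ : Ideal T₂ := Ideal.comap (Subring.inclusion hT₂O) (maximalIdeal (OE.comap (algebraMap K E)))
  haveI : P₂.IsPrime := Ideal.IsPrime.comap _
  have hP₂ : ∀ z : T₂, z ∈ P₂ ↔ OE.valuation (valₐ z) < 1 := fun z => by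
    change Subring.inclusion hT₂O z ∈ maximalIdeal (OE.comap (algebraMap K E)) ↔ _
    rw [ValuationSubring.valuation_lt_one_iff]
    exact valuation_comap_lt_one_iff OE (algebraMap K E) (z : K)
  have hmapO : (T₂.map valₐ).toSubring ≤ OE.toSubring := by
    intro z hz
    exact hRuO z (by rw [← hu]; exact hz)
  let Q' : Ideal (T₂.map valₐ) := Ideal.comap (Subring.inclusion hmapO) (maximalIdeal OE)
  haveI : Q'.IsPrime := Ideal.IsPrime.comap _
  have hQ' : ∀ z : T₂.map valₐ, z ∈ Q' ↔ OE.valuation (z : E) < 1 := fun z => by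
    change Subring.inclusion hmapO z ∈ maximalIdeal OE ↔ _
    rw [ValuationSubring.valuation_lt_one_iff]
    rfl
  have hregQ' : IsRegularLocalRing (Localization.AtPrime Q') :=
    (isRegularLocalRing_localization_map_iff valₐ OE T₂ P₂ hP₂ Q' hQ').mp hT₂reg
  have hRuO' : (Algebra.adjoin Sₚ u).toSubring ≤ OE.toSubring := fun z hz => hRuO z hz
  let Q : Ideal (Algebra.adjoin Sₚ u) := Ideal.comap (Subring.inclusion hRuO') (maximalIdeal OE)
  haveI : Q.IsPrime := Ideal.IsPrime.comap _
  have hQ : ∀ z : Algebra.adjoin Sₚ u, z ∈ Q ↔ OE.valuation (z : E) < 1 := fun z => by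
    change Subring.inclusion hRuO' z ∈ maximalIdeal OE ↔ _
    rw [ValuationSubring.valuation_lt_one_iff]
    rfl
  have hregQ : IsRegularLocalRing (Localization.AtPrime Q) :=
    (isRegularLocalRing_localization_iff_of_subalgebra_eq₃ OE hu Q' hQ' Q hQ).mp hregQ'
  let PA : Ideal (Algebra.adjoin S ((T₀ : Set E) ∪ u)) :=
    Ideal.comap (Subring.inclusion hAO) (maximalIdeal OE)
  haveI : PA.IsPrime := Ideal.IsPrime.comap _
  have hPA : ∀ z : Algebra.adjoin S ((T₀ : Set E) ∪ u), z ∈ PA ↔ OE.valuation (z : E) < 1 :=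
    fun z => by
      change Subring.inclusion hAO z ∈ maximalIdeal OE ↔ _
      rw [ValuationSubring.valuation_lt_one_iff]
      rfl
  exact (isRegularLocalRing_localization_adjoin_union_iff OE T₀ P₀ Sₚ hP₀ u PA hPA Q hQ).mpr hregQ

/-! ## One element -/

/-- **Cofinality, one element** ([CoP1] Cor. 4.6 for `n = 1`, from principalization): in the
climbing frame — `S` excellent regular local of dimension three inside a valued field `(E, O_E)`
dominating it with residue field algebraic over that of `S`, `M ∋ S` a subfield, a model
`S[t] ⊆ O_E` with `t ⊆ M ⊆ Frac(S)(t)` regular at the centre — every `x ∈ O_E ∩ M` lies in the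
local ring of a finer such model `S[t′]`, `t ⊆ t′ ⊆ M`: write `x = a/b` with `a, b ∈ S[t]`,
principalize `(a, b)` on `Spec S[t]_P` (`CossartPiltant2019Principalization`; the hypotheses by
`spec_satisfies_principalization_hypotheses`, the dimension of `S[t]_P` being three by the
dimension formula), and read `x` in the regular local ring dominated by `v` on the resulting
proper birational regular model (`exists_fg_regular_mem_of_isResolution`), a localization of
`S[t]_P[g₁, …, g_m] ⊇ S[t, g₁, …, g_m]` with the same local ring (`ModelTransport.lean`).
[cite: CossartPiltant2008, Cor. 4.6 (HAL p. 14)] [cite: CossartPiltant2019, Prop. 4.4] -/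
theorem exists_model_mem_localRing_of_principalization
    (h44 : CossartPiltant2019Principalization.{u})
    {S E : Type u} [CommRing S] [IsRegularLocalRing S] [Field E] [Algebra S E]
    (hS : IsExcellentRing S) (hSdim : ringKrullDim S = 3)
    (hinj : Function.Injective (algebraMap S E)) [Algebra.IsAlgebraic S E]
    (OE : ValuationSubring E) (hSO : ∀ s : S, algebraMap S E s ∈ OE)
    (hdom : ∀ s ∈ maximalIdeal S, OE.valuation (algebraMap S E s) < 1)
    (hres : ∀ y : OE, ∃ q : S[X], (∃ i, q.coeff i ∉ maximalIdeal S) ∧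
      OE.valuation (q.eval₂ (algebraMap S E) y) < 1)
    (M : Subfield E) (hSM : ∀ s : S, algebraMap S E s ∈ M)
    (t : Finset E) (htM : (t : Set E) ⊆ M)
    (hMcl : M ≤ Subfield.closure (Set.range (algebraMap S E) ∪ (t : Set E)))
    (hTO : (Algebra.adjoin S (t : Set E)).toSubring ≤ OE.toSubring)
    (hreg : IsRegularLocalRing (Localization.AtPrime
      (Ideal.comap (Subring.inclusion hTO) (maximalIdeal OE))))
    (x : E) (hxM : x ∈ M) (hxO : x ∈ OE) :
    ∃ t' : Finset E, t ⊆ t' ∧ (t' : Set E) ⊆ M ∧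
      M ≤ Subfield.closure (Set.range (algebraMap S E) ∪ (t' : Set E)) ∧
      ∃ hTO' : (Algebra.adjoin S (t' : Set E)).toSubring ≤ OE.toSubring,
        IsRegularLocalRing (Localization.AtPrime
          (Ideal.comap (Subring.inclusion hTO') (maximalIdeal OE))) ∧
        ∃ a s : E, a ∈ Algebra.adjoin S (t' : Set E) ∧ s ∈ Algebra.adjoin S (t' : Set E) ∧
          OE.valuation s = 1 ∧ x * s = a := by
  classical
  haveI : IsDomain S := isDomain_of_isRegularLocalRing S
  haveI : IsNoetherianRing S := hS.isUniversallyCatenaryRing.1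
  -- the model `T₀ = S[t]`, its centre `P₀`, and the local ring `R = (T₀)_{P₀}` inside `E`
  let T₀ : Subalgebra S E := Algebra.adjoin S (t : Set E)
  let P₀ : Ideal T₀ := Ideal.comap (Subring.inclusion hTO) (maximalIdeal OE)
  haveI : P₀.IsPrime := Ideal.IsPrime.comap _
  have hP₀ : ∀ z : T₀, z ∈ P₀ ↔ OE.valuation (z : E) < 1 := fun z => by
    change Subring.inclusion hTO z ∈ maximalIdeal OE ↔ _
    rw [ValuationSubring.valuation_lt_one_iff]
    rfl
  have hT₀O : ∀ z : T₀, (z : E) ∈ OE := fun z => hTO z.2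
  have hT₀M : ∀ z : T₀, (z : E) ∈ M := fun z => by
    refine Algebra.adjoin_induction (p := fun y _ => y ∈ M) ?_ ?_ ?_ ?_ z.2
    · exact fun y hy => htM hy
    · exact hSM
    · exact fun _ _ _ _ => M.add_mem
    · exact fun _ _ _ _ => M.mul_mem
  let R : Type u := Localization.AtPrime P₀
  haveI : IsRegularLocalRing R := hreg
  haveI : IsDomain R := isDomain_of_isRegularLocalRing R
  have hunits : ∀ y : P₀.primeCompl, IsUnit (algebraMap T₀ E y) := fun y => by
    rw [isUnit_iff_ne_zero]
    intro h0
    apply y.2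
    have : (y : T₀) = 0 := Subtype.ext h0
    rw [this]
    exact P₀.zero_mem
  letI : Algebra R E := (IsLocalization.lift (M := P₀.primeCompl) hunits).toAlgebra
  haveI : IsScalarTower T₀ R E :=
    IsScalarTower.of_algebraMap_eq fun a => (IsLocalization.lift_eq hunits a).symm
  haveI : IsScalarTower S R E := IsScalarTower.of_algebraMap_eq fun s => by
    rw [IsScalarTower.algebraMap_apply S T₀ R, ← IsScalarTower.algebraMap_apply T₀ R E,
      ← IsScalarTower.algebraMap_apply S T₀ E]
  -- values of the elements of `R`
  have hval : ∀ (a : T₀) (b : P₀.primeCompl),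
      algebraMap R E (IsLocalization.mk' R a b) = (a : E) * (((b : T₀) : E))⁻¹ ∧
        OE.valuation ((b : T₀) : E) = 1 := by
    intro a b
    have hb : OE.valuation ((b : T₀) : E) = 1 := by
      have hle : OE.valuation ((b : T₀) : E) ≤ 1 := (OE.valuation_le_one_iff _).mpr (hT₀O _)
      have hnlt : ¬ OE.valuation ((b : T₀) : E) < 1 := fun hlt => b.2 ((hP₀ _).mpr hlt)
      exact le_antisymm hle (not_lt.mp hnlt)
    have hb0 : ((b : T₀) : E) ≠ 0 := fun h0 => by rw [h0, map_zero] at hb; exact zero_ne_one hb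
    refine ⟨?_, hb⟩
    have h1 := IsLocalization.mk'_spec R a b
    have h2 := congrArg (algebraMap R E) h1
    rw [map_mul, ← IsScalarTower.algebraMap_apply, ← IsScalarTower.algebraMap_apply] at h2
    have h3 : algebraMap R E (IsLocalization.mk' R a b) * ((b : T₀) : E) = (a : E) := h2
    rw [← h3, mul_inv_cancel_right₀ hb0]
  have hRO : ∀ r : R, algebraMap R E r ∈ OE := by
    intro r
    obtain ⟨⟨a, b⟩, rfl⟩ := IsLocalization.mk'_surjective P₀.primeCompl r
    obtain ⟨hab, hb⟩ := hval a b
    rw [hab]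
    refine mul_mem (hT₀O a) ?_
    rw [← OE.valuation_le_one_iff, map_inv₀, hb, inv_one]
  have hRM : ∀ r : R, algebraMap R E r ∈ M := by
    intro r
    obtain ⟨⟨a, b⟩, rfl⟩ := IsLocalization.mk'_surjective P₀.primeCompl r
    rw [(hval a b).1]
    exact M.mul_mem (hT₀M a) (M.inv_mem (hT₀M _))
  have hinjR : Function.Injective (algebraMap R E) := by
    change Function.Injective (IsLocalization.lift (M := P₀.primeCompl) hunits)
    refine (IsLocalization.lift_injective_iff _).mpr fun a b => ⟨fun h => ?_, fun h => ?_⟩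
    · rw [IsLocalization.injective R P₀.primeCompl_le_nonZeroDivisors h]
    · rw [Subtype.val_injective h]
  -- `R` is excellent of dimension three
  haveI : Algebra.FiniteType S T₀ :=
    (Subalgebra.fg_iff_finiteType _).mp (Subalgebra.fg_adjoin_finset _)
  have hexcR : IsExcellentRing R := isExcellentRing_localization_atPrime hS P₀
  haveI : FaithfulSMul S T₀ := (faithfulSMul_iff_algebraMap_injective _ _).mpr fun a b hab =>
    hinj (by
      have h1 := congrArg (fun z : T₀ => (z : E)) hab
      exact h1)
  haveI : Algebra.IsAlgebraic S T₀ :=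
    Algebra.IsAlgebraic.of_injective T₀.val Subtype.val_injective
  haveI := liesOver_maximalIdeal_of_forall_valuation_lt_one OE hSO hdom T₀ P₀ hP₀
  haveI := isAlgebraic_quotient_of_forall_valuation_lt_one OE hres T₀ hT₀O P₀ hP₀
  have hdimR : ringKrullDim R = 3 := by
    rw [← hSdim]
    exact ringKrullDim_localization_eq_of_isUniversallyCatenaryRing hS.isUniversallyCatenaryRing P₀
  -- `M` as a type: `R → ↥M → E`, `Frac R = M`, and the valuation ring `O = O_E ∩ M`
  let K : Type u := M
  letI : Algebra R K := ((algebraMap R E).codRestrict M hRM).toAlgebra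
  haveI : IsScalarTower R K E := IsScalarTower.of_algebraMap_eq fun _ => rfl
  haveI : FaithfulSMul R K := (faithfulSMul_iff_algebraMap_injective R K).mpr fun a b hab =>
    hinjR (by
      have := congrArg (fun z : K => (z : E)) hab
      exact this)
  have hT₀R : ∀ z : T₀, (algebraMap R K (algebraMap T₀ R z) : E) = (z : E) := fun z => by
    change algebraMap R E (algebraMap T₀ R z) = (z : E)
    rw [← IsScalarTower.algebraMap_apply T₀ R E]
    rfl
  haveI : IsFractionRing R K := by
    refine IsFractionRing.of_field R K fun z => ?_
    obtain ⟨a, b, ha, hb, hb0, hzab⟩ := exists_div_eq_of_mem_closure' (t : Set E) (hMcl z.2)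
    refine ⟨algebraMap T₀ R ⟨a, ha⟩, algebraMap T₀ R ⟨b, hb⟩, Subtype.ext ?_⟩
    change (z : E) = ((algebraMap R K (algebraMap T₀ R ⟨a, ha⟩) / algebraMap R K (algebraMap T₀ R ⟨b, hb⟩) : K) : E)
    rw [Subfield.coe_div, hT₀R, hT₀R]
    exact hzab
  let O : ValuationSubring K := OE.comap (algebraMap K E)
  have hROK : ∀ r : R, algebraMap R K r ∈ O := fun r => hRO r
  -- `x = a₀/b₀` with `a₀, b₀ ∈ S[t]`
  obtain ⟨a₀, b₀, ha₀, hb₀, hb₀0, hxab⟩ := exists_div_eq_of_mem_closure' (t : Set E) (hMcl hxM)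
  let a : R := algebraMap T₀ R ⟨a₀, ha₀⟩
  let b : R := algebraMap T₀ R ⟨b₀, hb₀⟩
  have hbne : b ≠ 0 := fun h0 => hb₀0 (by
    have h1 : (⟨b₀, hb₀⟩ : T₀) = 0 :=
      IsLocalization.injective R P₀.primeCompl_le_nonZeroDivisors (by rw [map_zero]; exact h0)
    exact congrArg Subtype.val h1)
  have haK : (algebraMap R K a : E) = a₀ := hT₀R ⟨a₀, ha₀⟩
  have hbK : (algebraMap R K b : E) = b₀ := hT₀R ⟨b₀, hb₀⟩
  have hxK : ((algebraMap R K a / algebraMap R K b : K) : E) = x := by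
    rw [Subfield.coe_div, haK, hbK, hxab]
  have hxOK : algebraMap R K a / algebraMap R K b ∈ O := by
    change ((algebraMap R K a / algebraMap R K b : K) : E) ∈ OE
    rw [hxK]
    exact hxO
  -- principalize `(a, b)` on `Spec R`
  obtain ⟨hint, hnoeth, hregS, hexcS, hdimS⟩ :=
    spec_satisfies_principalization_hypotheses R hexcR hdimR
  haveI := hint
  haveI := hnoeth
  let J : (Spec (.of R)).IdealSheafData :=
    ofIdealTop (Ideal.span {(Scheme.ΓSpecIso (.of R)).inv a, (Scheme.ΓSpecIso (.of R)).inv b})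
  have hJ : J ≠ ⊥ := by
    intro hJ0
    have h1 : J.ideal ⟨⊤, isAffineOpen_top _⟩ = ⊥ := by
      rw [hJ0]
      rfl
    have h2 : (Scheme.ΓSpecIso (.of R)).inv b ∈ J.ideal ⟨⊤, isAffineOpen_top _⟩ := by
      change _ ∈ (ofIdealTop _).ideal _
      rw [Scheme.IdealSheafData.ofIdealTop_ideal]
      exact Ideal.mem_map_of_mem _ (Ideal.subset_span
        (Set.mem_insert_of_mem _ (Set.mem_singleton _)))
    rw [h1, Ideal.mem_bot] at h2
    apply hbne
    exact (ConcreteCategory.bijective_of_isIso (Scheme.ΓSpecIso (.of R)).inv).1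
      (h2.trans (map_zero _).symm)
  obtain ⟨X, σ, hseq, hprinc⟩ := h44 (Spec (.of R)) hregS hexcS hdimS J hJ
  have hresσ : IsResolution σ := hseq.isResolution hJ hregS
  -- the finer model over `R`, inside `K = M`
  obtain ⟨T₂, hT₂O, hT₂fg, hT₂reg, y, s, hy, hs, hvs, hxs⟩ :=
    exists_fg_regular_mem_of_isResolution (A := R) (K := K) O hROK hresσ a b hbne hxOK hprinc
  obtain ⟨fs, hfs⟩ := hT₂fg
  -- back to `E`
  let valₐ : K →ₐ[R] E := IsScalarTower.toAlgHom R K E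
  have hval' : ∀ z : K, valₐ z = (z : E) := fun _ => rfl
  let u : Finset E := fs.image (fun z : K => (z : E))
  have hT₂map : (T₂.map valₐ : Subalgebra R E) = Algebra.adjoin R (u : Set E) := by
    rw [← hfs, AlgHom.map_adjoin, Finset.coe_image]
    rfl
  have huM : (u : Set E) ⊆ M := by
    intro z hz
    obtain ⟨w, -, rfl⟩ := Finset.mem_image.mp (Finset.mem_coe.mp hz)
    exact w.2
  -- the new model `S[t ∪ u]` and the model `R[u]` over the local base
  let A : Subalgebra S E := Algebra.adjoin S ((T₀ : Set E) ∪ (u : Set E))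
  have hAmem : ∀ z : A, (z : E) ∈ Algebra.adjoin R (u : Set E) := fun z =>
    mem_adjoin_localization_of_mem_adjoin_union T₀ R (u : Set E) z.2
  have hRuO : ∀ z : E, z ∈ Algebra.adjoin R (u : Set E) → z ∈ OE := by
    intro z hz
    rw [← hT₂map] at hz
    obtain ⟨w, hw, rfl⟩ := Subalgebra.mem_map.mp hz
    exact hT₂O hw
  have hAO : A.toSubring ≤ OE.toSubring := fun z hz => hRuO z (hAmem ⟨z, hz⟩)
  -- regularity of `S[t ∪ u]` at the centre (through `R[u]` and `T₂ ⊆ M`)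
  have hregA : IsRegularLocalRing (Localization.AtPrime
      (Ideal.comap (Subring.inclusion hAO) (maximalIdeal OE))) :=
    isRegularLocalRing_adjoin_union_of_map_eq OE T₀ P₀ hP₀ R K T₂ hT₂O hT₂reg (u : Set E) hT₂map hAO
  let PA : Ideal A := Ideal.comap (Subring.inclusion hAO) (maximalIdeal OE)
  haveI : PA.IsPrime := Ideal.IsPrime.comap _
  have hPA : ∀ z : A, z ∈ PA ↔ OE.valuation (z : E) < 1 := fun z => by
    change Subring.inclusion hAO z ∈ maximalIdeal OE ↔ _
    rw [ValuationSubring.valuation_lt_one_iff]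
    rfl
  -- `t' = t ∪ u`
  have hset : Algebra.adjoin S ((t ∪ u : Finset E) : Set E) = A := by
    rw [Finset.coe_union]
    apply le_antisymm
    · apply Algebra.adjoin_le
      rintro z (hz | hz)
      · exact Algebra.subset_adjoin (Set.mem_union_left _ (Algebra.subset_adjoin hz))
      · exact Algebra.subset_adjoin (Set.mem_union_right _ hz)
    · apply Algebra.adjoin_le
      rintro z (hz | hz)
      · exact Algebra.adjoin_mono Set.subset_union_left hz
      · exact Algebra.subset_adjoin (Set.mem_union_right _ hz)
  have hTOnew : (Algebra.adjoin S ((t ∪ u : Finset E) : Set E)).toSubring ≤ OE.toSubring := by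
    rw [hset]
    exact hAO
  -- the representation `x · s' = a'` with `a', s' ∈ S[t ∪ u]`, `v(s') = 1`
  have hsE : OE.valuation (s : E) = 1 := by
    have hsO : s ∈ O := (O.valuation_le_one_iff s).mp (le_of_eq hvs)
    have hle : OE.valuation (s : E) ≤ 1 := (OE.valuation_le_one_iff _).mpr hsO
    have hnlt : ¬ OE.valuation (s : E) < 1 := fun hlt => by
      have h1 : O.valuation s < 1 := (valuation_comap_lt_one_iff OE (algebraMap K E) s).mpr hlt
      rw [hvs] at h1
      exact lt_irrefl _ h1
    exact le_antisymm hle (not_lt.mp hnlt)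
  have hxsE : x * (s : E) = (y : E) := by
    have h1 : (((algebraMap R K a / algebraMap R K b * s : K)) : E) = (y : E) :=
      congrArg Subtype.val hxs
    rw [Subfield.coe_mul, hxK] at h1
    exact h1
  have hyRu : (y : E) ∈ Algebra.adjoin R (u : Set E) := by
    rw [← hT₂map]; exact Subalgebra.mem_map.mpr ⟨y, hy, rfl⟩
  have hsRu : (s : E) ∈ Algebra.adjoin R (u : Set E) := by
    rw [← hT₂map]; exact Subalgebra.mem_map.mpr ⟨s, hs, rfl⟩
  obtain ⟨y₁, d₁, hy₁, hd₁T, hd₁P, hyd⟩ :=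
    exists_mul_mem_adjoin_of_mem_adjoin_localization T₀ P₀ R (u : Set E) (y : E) hyRu
  obtain ⟨s₁, d₂, hs₁, hd₂T, hd₂P, hsd⟩ :=
    exists_mul_mem_adjoin_of_mem_adjoin_localization T₀ P₀ R (u : Set E) (s : E) hsRu
  have hvd : ∀ d : E, ∀ hd : d ∈ T₀, (⟨d, hd⟩ : T₀) ∉ P₀ → OE.valuation d = 1 := fun d hd hdP => by
    have hle : OE.valuation d ≤ 1 := (OE.valuation_le_one_iff _).mpr (hT₀O ⟨d, hd⟩)
    have hnlt : ¬ OE.valuation d < 1 := fun hlt => hdP ((hP₀ ⟨d, hd⟩).mpr hlt)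
    exact le_antisymm hle (not_lt.mp hnlt)
  have hTA : ∀ z : E, z ∈ T₀ → z ∈ A := fun z hz => Algebra.subset_adjoin (Set.mem_union_left _ hz)
  refine ⟨t ∪ u, Finset.subset_union_left, ?_, ?_, hTOnew, ?_, ?_⟩
  · rw [Finset.coe_union]
    exact Set.union_subset htM huM
  · exact hMcl.trans (Subfield.closure_mono (Set.union_subset_union_right _ (by
      rw [Finset.coe_union]; exact Set.subset_union_left)))
  · let P₁ : Ideal (Algebra.adjoin S ((t ∪ u : Finset E) : Set E)) :=
      Ideal.comap (Subring.inclusion hTOnew) (maximalIdeal OE)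
    haveI : P₁.IsPrime := Ideal.IsPrime.comap _
    have hP₁ : ∀ z : Algebra.adjoin S ((t ∪ u : Finset E) : Set E),
        z ∈ P₁ ↔ OE.valuation (z : E) < 1 := fun z => by
      change Subring.inclusion hTOnew z ∈ maximalIdeal OE ↔ _
      rw [ValuationSubring.valuation_lt_one_iff]
      rfl
    exact (isRegularLocalRing_localization_iff_of_subalgebra_eq₃ OE hset P₁ hP₁ PA hPA).mpr hregA
  · refine ⟨y₁ * d₂, s₁ * d₁, ?_, ?_, ?_, ?_⟩
    · rw [hset]
      exact mul_mem hy₁ (hTA d₂ hd₂T)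
    · rw [hset]
      exact mul_mem hs₁ (hTA d₁ hd₁T)
    · have h1 : OE.valuation (s₁ * d₁) =
          OE.valuation (s : E) * OE.valuation d₂ * OE.valuation d₁ := by
        rw [map_mul, ← hsd, map_mul]
      rw [h1, hsE, hvd d₂ hd₂T (hd₂P hd₂T), hvd d₁ hd₁T (hd₁P hd₁T), one_mul, one_mul]
    · rw [← hyd, ← hsd, ← hxsE]
      ring


/-! ## The hypothesis (COF) -/

/-- **`CossartPiltant2019Principalization` implies cofinality of local uniformizations** — the
hypothesis (COF) of `cossartPiltant2019ReductionP_of_parts` (up to its redundant `[IsDomain S]`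
binder) ([CoP1] Cor. 4.6: "By
induction on `n`, it can then be assumed that `A₀ ⊆ R′`"): induction on the finite set of
elements, with `exists_model_mem_localRing_of_principalization` (the models only grow, `t ⊆ t′`,
so elements already in the local ring stay there with the same representation).
[cite: CossartPiltant2008, Cor. 4.6 (HAL p. 14)] [cite: CossartPiltant2019, Prop. 4.4] -/
theorem cofinality_of_principalization (h44 : CossartPiltant2019Principalization.{u}) :
      ∀ (p : ℕ), p.Prime →
      ∀ (S : Type u) [CommRing S] [IsRegularLocalRing S],
        IsExcellentRing S → ringKrullDim S = 3 → CharP (ResidueField S) p →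
        IsAdicComplete (maximalIdeal S) S →
      ∀ (E : Type u) [Field E] [Algebra S E], Function.Injective (algebraMap S E) →
        IsAlgClosed E → Algebra.IsAlgebraic S E →
      ∀ (OE : ValuationSubring E), (∀ s : S, algebraMap S E s ∈ OE) →
        (∀ s ∈ maximalIdeal S, OE.valuation (algebraMap S E s) < 1) →
        (∀ y : OE, ∃ q : S[X], (∃ i, q.coeff i ∉ maximalIdeal S) ∧
          OE.valuation (q.eval₂ (algebraMap S E) y) < 1) →
      ∀ (M : Subfield E), (∀ s : S, algebraMap S E s ∈ M) →
      ∀ (t : Finset E), (t : Set E) ⊆ M →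
        M ≤ Subfield.closure (Set.range (algebraMap S E) ∪ (t : Set E)) →
      ∀ (hTO : (Algebra.adjoin S (t : Set E)).toSubring ≤ OE.toSubring),
        IsRegularLocalRing (Localization.AtPrime
          (Ideal.comap (Subring.inclusion hTO) (maximalIdeal OE))) →
      ∀ (c : Finset E), (c : Set E) ⊆ M → (∀ x ∈ c, x ∈ OE) →
      ∃ t' : Finset E, (t' : Set E) ⊆ M ∧
        M ≤ Subfield.closure (Set.range (algebraMap S E) ∪ (t' : Set E)) ∧
        ∃ hTO' : (Algebra.adjoin S (t' : Set E)).toSubring ≤ OE.toSubring,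
          IsRegularLocalRing (Localization.AtPrime
            (Ideal.comap (Subring.inclusion hTO') (maximalIdeal OE))) ∧
          ∀ x ∈ c, ∃ a s : E, a ∈ Algebra.adjoin S (t' : Set E) ∧
            s ∈ Algebra.adjoin S (t' : Set E) ∧ OE.valuation s = 1 ∧ x * s = a := by
  intro p hp S _ _ hS hSdim hSchar hScomp E _ _ hinj hE halg OE hSO hdom hres M hSM t htM hMcl
    hTO hreg c
  classical
  -- induction on `c`, for all models at once
  induction c using Finset.induction_on generalizing t with
  | empty =>
    intro _ _
    exact ⟨t, htM, hMcl, hTO, hreg, fun x hx => absurd hx (Finset.notMem_empty x)⟩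
  | insert x₀ c hx₀ ih =>
    intro hcM hcO
    have hcM' : ((c : Finset E) : Set E) ⊆ M := fun z hz =>
      hcM (by rw [Finset.coe_insert]; exact Set.mem_insert_of_mem _ hz)
    have hcO' : ∀ x ∈ c, x ∈ OE := fun x hx => hcO x (Finset.mem_insert_of_mem hx)
    obtain ⟨t₁, ht₁M, hMcl₁, hTO₁, hreg₁, hrep₁⟩ := ih t htM hMcl hTO hreg hcM' hcO'
    have hx₀M : x₀ ∈ M := hcM (by rw [Finset.coe_insert]; exact Set.mem_insert _ _)
    have hx₀O : x₀ ∈ OE := hcO x₀ (Finset.mem_insert_self _ _)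
    obtain ⟨t₂, ht₁₂, ht₂M, hMcl₂, hTO₂, hreg₂, a, s, ha, hs, hvs, hxs⟩ :=
      exists_model_mem_localRing_of_principalization h44 hS hSdim hinj OE hSO hdom hres M hSM t₁
        ht₁M hMcl₁ hTO₁ hreg₁ x₀ hx₀M hx₀O
    have hmono : Algebra.adjoin S (t₁ : Set E) ≤ Algebra.adjoin S (t₂ : Set E) :=
      Algebra.adjoin_mono (Finset.coe_subset.mpr ht₁₂)
    refine ⟨t₂, ht₂M, hMcl₂, hTO₂, hreg₂, fun x hx => ?_⟩
    rcases Finset.mem_insert.mp hx with rfl | hx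
    · exact ⟨a, s, ha, hs, hvs, hxs⟩
    · obtain ⟨a', s', ha', hs', hvs', hxs'⟩ := hrep₁ x hx
      exact ⟨a', s', hmono ha', hmono hs', hvs', hxs'⟩


end Literature.AlgebraicGeometry.Resolution

end
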